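import Mathlib

/-!
# LEMMA G2-QUANT (symmetric, mine-3 MINE3-GLUING v11 §16): the bilinear corner argument

For `a ↔ b`-symmetric states `B`, `C` in the normalised coordinates `x = Z/Mₐ`, `k = K` on the C-028 ∧
Harris band `max(0, (2x − 1)/(2 − x)) ≤ k ≤ x/(2 − x)`, the slack of the gluing obeys
`Δ(B ⊙ C)/(a_B a_C) = 1 + 2k_B k_C − x_B x_C(2 + k_B k_C) ≥ 2(1 − x_B)(1 − x_C)·k_C(1 − k_B)`
(`g2quantSym_F1_nonneg`; the other term of mine-3's `max` follows by the symmetry `B ↔ C`,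
`g2quantSym`).  Proof: `F₁ := Δ − 2(1 − x_B)(1 − x_C)k_C(1 − k_B)` is bilinear in `(k_B, k_C)` with
nonnegative `k_B`-slope, so it is minimised at `k_B = k_B^min`, then at an end of the `k_C`-interval;
the six corners are explicit: e.g. `(k_B^lo, k_C^hi)` gives
`(1 − x_C)(4 − 2x_B − 6x_C + 7x_B x_C − 2x_B² x_C)/((2 − x_B)(2 − x_C))` and `(k_B^lo, k_C^lo)` gives
`6(1 − x_B)(1 − x_C)²/(2 − x_C)` (mine-3's `6AB²/(1 + B)`).
-/

namespace PercRepro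

/-- `F₁(x_B, x_C, k_B, k_C) = 1 + 2k_B k_C − x_B x_C(2 + k_B k_C) − 2(1 − x_B)(1 − x_C)k_C(1 − k_B)`. -/
def g2F1 (xB xC kB kC : ℝ) : ℝ :=
  1 + 2 * kB * kC - xB * xC * (2 + kB * kC) - 2 * (1 - xB) * (1 - xC) * kC * (1 - kB)

/-- `F₁` is affine in `k_B` with slope `k_C·(4 − 2x_B − 2x_C + x_B x_C)`. -/
theorem g2F1_kB (xB xC kB kB' kC : ℝ) :
    g2F1 xB xC kB kC - g2F1 xB xC kB' kC = (kB - kB') * (kC * (4 - 2 * xB - 2 * xC + xB * xC)) := by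
  unfold g2F1; ring

/-- `F₁` is affine in `k_C`. -/
theorem g2F1_kC (xB xC kB kC kC' : ℝ) :
    g2F1 xB xC kB kC - g2F1 xB xC kB kC' =
      (kC - kC') * (kB * (4 - 2 * xB - 2 * xC + xB * xC) - 2 * (1 - xB) * (1 - xC)) := by
  unfold g2F1; ring

/-- Corner `(k_B^lo, k_C^hi)`. -/
theorem g2F1_lo_hi {xB xC : ℝ} (hB : xB ≠ 2) (hC : xC ≠ 2) :
    g2F1 xB xC ((2 * xB - 1) / (2 - xB)) (xC / (2 - xC)) =
      (1 - xC) * (4 - 2 * xB - 6 * xC + 7 * xB * xC - 2 * xB ^ 2 * xC) / ((2 - xB) * (2 - xC)) := by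
  have h1 : (2 - xB) ≠ 0 := sub_ne_zero.2 (Ne.symm hB)
  have h2 : (2 - xC) ≠ 0 := sub_ne_zero.2 (Ne.symm hC)
  unfold g2F1
  field_simp
  ring

/-- Corner `(k_B^lo, k_C^lo)`: `6(1 − x_B)(1 − x_C)²/(2 − x_C)`. -/
theorem g2F1_lo_lo {xB xC : ℝ} (hB : xB ≠ 2) (hC : xC ≠ 2) :
    g2F1 xB xC ((2 * xB - 1) / (2 - xB)) ((2 * xC - 1) / (2 - xC)) =
      6 * (1 - xB) * (1 - xC) ^ 2 / (2 - xC) := by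
  have h1 : (2 - xB) ≠ 0 := sub_ne_zero.2 (Ne.symm hB)
  have h2 : (2 - xC) ≠ 0 := sub_ne_zero.2 (Ne.symm hC)
  unfold g2F1
  field_simp
  ring

/-- Corner `(0, k_C^hi)`: `(2 − 3x_C + 2x_C² − 2x_B x_C)/(2 − x_C)`. -/
theorem g2F1_zero_hi {xB xC : ℝ} (hC : xC ≠ 2) :
    g2F1 xB xC 0 (xC / (2 - xC)) = (2 - 3 * xC + 2 * xC ^ 2 - 2 * xB * xC) / (2 - xC) := by
  have h2 : (2 - xC) ≠ 0 := sub_ne_zero.2 (Ne.symm hC)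
  unfold g2F1
  field_simp
  ring

/-- Corner `(0, k_C^lo)`: `(4 − 7x_C + 4x_C² − 2x_B + 2x_B x_C − 2x_B x_C²)/(2 − x_C)`. -/
theorem g2F1_zero_lo {xB xC : ℝ} (hC : xC ≠ 2) :
    g2F1 xB xC 0 ((2 * xC - 1) / (2 - xC)) =
      (4 - 7 * xC + 4 * xC ^ 2 - 2 * xB + 2 * xB * xC - 2 * xB * xC ^ 2) / (2 - xC) := by
  have h2 : (2 - xC) ≠ 0 := sub_ne_zero.2 (Ne.symm hC)
  unfold g2F1
  field_simp
  ring

/-- Corner `(k_B, 0)`: `1 − 2x_B x_C`. -/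
theorem g2F1_zero_kC (xB xC kB : ℝ) : g2F1 xB xC kB 0 = 1 - 2 * xB * xC := by
  unfold g2F1; ring

/-- The lower end of the band: `k^lo = max 0 ((2x − 1)/(2 − x))`. -/
noncomputable def kLo (x : ℝ) : ℝ := max 0 ((2 * x - 1) / (2 - x))

/-- The upper end of the band (Harris): `k^hi = x/(2 − x)`. -/
noncomputable def kHi (x : ℝ) : ℝ := x / (2 - x)

/-- Every corner of the band is nonnegative (the six explicit values). -/
theorem g2F1_corners_nonneg {xB xC : ℝ} (hB0 : 0 ≤ xB) (hB1 : xB ≤ 1) (hC0 : 0 ≤ xC)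
    (hC1 : xC ≤ 1) :
    0 ≤ g2F1 xB xC (kLo xB) (kLo xC) ∧ 0 ≤ g2F1 xB xC (kLo xB) (kHi xC) := by
  have hB2 : xB ≠ 2 := by intro h; linarith
  have hC2 : xC ≠ 2 := by intro h; linarith
  have hdB : 0 < 2 - xB := by linarith
  have hdC : 0 < 2 - xC := by linarith
  -- the lower ends
  have hloB : kLo xB = if (1 : ℝ) / 2 ≤ xB then (2 * xB - 1) / (2 - xB) else 0 := by
    unfold kLo
    split_ifs with h
    · exact max_eq_right (div_nonneg (by linarith) hdB.le)
    · exact max_eq_left (div_nonpos_of_nonpos_of_nonneg (by have := not_le.mp h; linarith) hdB.le)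
  have hloC : kLo xC = if (1 : ℝ) / 2 ≤ xC then (2 * xC - 1) / (2 - xC) else 0 := by
    unfold kLo
    split_ifs with h
    · exact max_eq_right (div_nonneg (by linarith) hdC.le)
    · exact max_eq_left (div_nonpos_of_nonpos_of_nonneg (by have := not_le.mp h; linarith) hdC.le)
  unfold kHi
  rw [hloB, hloC]
  split_ifs with h1 h2 h2
  · -- (lo, lo) and (lo, hi)
    refine ⟨?_, ?_⟩
    · rw [g2F1_lo_lo hB2 hC2]
      apply div_nonneg _ hdC.le
      have : 0 ≤ 1 - xB := by linarith
      positivity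
    · rw [g2F1_lo_hi hB2 hC2]
      apply div_nonneg _ (mul_pos hdB hdC).le
      have h1C : 0 ≤ 1 - xC := by linarith
      have hbr : 0 ≤ 4 - 2 * xB - 6 * xC + 7 * xB * xC - 2 * xB ^ 2 * xC := by
        have e : 4 - 2 * xB - 6 * xC + 7 * xB * xC - 2 * xB ^ 2 * xC =
            (1 - xC) * (4 - 2 * xB) + xC * ((2 * xB - 1) * (2 - xB)) := by ring
        rw [e]
        have h21 : 0 ≤ 2 * xB - 1 := by linarith
        exact add_nonneg (mul_nonneg h1C (by linarith)) (mul_nonneg hC0 (mul_nonneg h21 hdB.le))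
      exact mul_nonneg h1C hbr
  · -- (lo, 0) and (lo, hi)
    refine ⟨?_, ?_⟩
    · rw [g2F1_zero_kC]; have := not_le.mp h2; nlinarith
    · rw [g2F1_lo_hi hB2 hC2]
      apply div_nonneg _ (mul_pos hdB hdC).le
      have h1C : 0 ≤ 1 - xC := by linarith
      have hbr : 0 ≤ 4 - 2 * xB - 6 * xC + 7 * xB * xC - 2 * xB ^ 2 * xC := by
        have e : 4 - 2 * xB - 6 * xC + 7 * xB * xC - 2 * xB ^ 2 * xC =
            (1 - xC) * (4 - 2 * xB) + xC * ((2 * xB - 1) * (2 - xB)) := by ring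
        rw [e]
        have h21 : 0 ≤ 2 * xB - 1 := by linarith
        exact add_nonneg (mul_nonneg h1C (by linarith)) (mul_nonneg hC0 (mul_nonneg h21 hdB.le))
      exact mul_nonneg h1C hbr
  · -- (0, lo) and (0, hi)
    have h1 := not_le.mp h1
    refine ⟨?_, ?_⟩
    · rw [g2F1_zero_lo hC2]
      apply div_nonneg _ hdC.le
      nlinarith [sq_nonneg (1 - xC), mul_nonneg hB0 (sq_nonneg (1 - xC))]
    · rw [g2F1_zero_hi hC2]
      apply div_nonneg _ hdC.le
      nlinarith [sq_nonneg (1 - xC)]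
  · -- (0, 0) and (0, hi)
    have h1 := not_le.mp h1
    have h2 := not_le.mp h2
    refine ⟨?_, ?_⟩
    · rw [g2F1_zero_kC]; nlinarith
    · rw [g2F1_zero_hi hC2]
      apply div_nonneg _ hdC.le
      nlinarith [sq_nonneg (1 - xC)]

/-- **LEMMA G2-QUANT, one term**: on the band, `F₁ ≥ 0`. -/
theorem g2quantSym_F1_nonneg {xB xC kB kC : ℝ} (hB0 : 0 ≤ xB) (hB1 : xB ≤ 1) (hC0 : 0 ≤ xC)
    (hC1 : xC ≤ 1) (hkB : kLo xB ≤ kB) (hkC0 : kLo xC ≤ kC) (hkC1 : kC ≤ kHi xC) :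
    0 ≤ g2F1 xB xC kB kC := by
  obtain ⟨c1, c2⟩ := g2F1_corners_nonneg hB0 hB1 hC0 hC1
  have hkC0' : 0 ≤ kC := le_trans (le_max_left _ _) hkC0
  -- step 1: down to `k_B = k_B^lo`
  have hS : 0 ≤ 4 - 2 * xB - 2 * xC + xB * xC := by nlinarith
  have s1 : g2F1 xB xC (kLo xB) kC ≤ g2F1 xB xC kB kC := by
    have := g2F1_kB xB xC kB (kLo xB) kC
    have : 0 ≤ (kB - kLo xB) * (kC * (4 - 2 * xB - 2 * xC + xB * xC)) :=
      mul_nonneg (by linarith) (mul_nonneg hkC0' hS)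
    linarith
  -- step 2: affine in `k_C` on `[k_C^lo, k_C^hi]`
  have s2 : 0 ≤ g2F1 xB xC (kLo xB) kC := by
    set m := kLo xB * (4 - 2 * xB - 2 * xC + xB * xC) - 2 * (1 - xB) * (1 - xC) with hm
    have e1 := g2F1_kC xB xC (kLo xB) kC (kLo xC)
    have e2 := g2F1_kC xB xC (kLo xB) kC (kHi xC)
    rcases le_or_gt 0 m with hm0 | hm0
    · have : 0 ≤ (kC - kLo xC) * m := mul_nonneg (by linarith) hm0
      linarith
    · have : 0 ≤ (kHi xC - kC) * (-m) := mul_nonneg (by linarith) (by linarith)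
      nlinarith
  linarith

/-- **LEMMA G2-QUANT (symmetric)**: on the band,
`1 + 2k_B k_C − x_B x_C(2 + k_B k_C) ≥ 2(1 − x_B)(1 − x_C)·max(k_C(1 − k_B), k_B(1 − k_C))`. -/
theorem g2quantSym {xB xC kB kC : ℝ} (hB0 : 0 ≤ xB) (hB1 : xB ≤ 1) (hC0 : 0 ≤ xC) (hC1 : xC ≤ 1)
    (hkB0 : kLo xB ≤ kB) (hkB1 : kB ≤ kHi xB) (hkC0 : kLo xC ≤ kC) (hkC1 : kC ≤ kHi xC) :
    2 * (1 - xB) * (1 - xC) * max (kC * (1 - kB)) (kB * (1 - kC)) ≤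
      1 + 2 * kB * kC - xB * xC * (2 + kB * kC) := by
  have h1 := g2quantSym_F1_nonneg hB0 hB1 hC0 hC1 hkB0 hkC0 hkC1
  have h2 := g2quantSym_F1_nonneg hC0 hC1 hB0 hB1 hkC0 hkB0 hkB1
  unfold g2F1 at h1 h2
  have hpos : 0 ≤ 2 * (1 - xB) * (1 - xC) := by
    have : 0 ≤ 1 - xB := by linarith
    have : 0 ≤ 1 - xC := by linarith
    positivity
  rcases le_total (kC * (1 - kB)) (kB * (1 - kC)) with h | h
  · rw [max_eq_right h]; nlinarith
  · rw [max_eq_left h]; nlinarith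

end PercRepro
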